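import Literature.NumberTheory.EllipticCurves.DivisionPolynomialMultiplication
import Literature.NumberTheory.EllipticCurves.DivisionPolynomialTorsion
import Literature.NumberTheory.EllipticCurves.FormalGroupChart
import Mathlib.AlgebraicGeometry.EllipticCurve.DivisionPolynomial.Degree
import Mathlib.Analysis.Normed.Group.Ultra
import Mathlib.Topology.Algebra.Valued.NormedValued
import HarnessLib

/-!
# `E₁(K)[p] = 0` over an unramified `p`-adic field, `p ≥ 3` (Silverman, *AEC* VII.3.1 with IV.6.1)

Sibling of the tree's `ℚ_p` case `not_prime_zsmul_eq_zero_of_one_lt_norm`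
(`MazurTorsionStepOneAtNProofs`, §1), by the same elementary division-polynomial argument, for an
arbitrary ultrametric normed field `K` in which `p` is a uniformiser in the weak sense
`0 < ‖p‖ < 1` and `‖z‖ < 1 ⇒ ‖z‖ ≤ ‖p‖` (absolute ramification index `1`; e.g. the completion `L_w` of a
number field at a place `w ∣ p` unramified over `p`, with either normalisation of the norm):

* `norm_sq_eq_norm_cube` — `‖y‖² = ‖x‖³` for `(x, y)` on an integral equation with `‖x‖ > 1`;
* `inv_norm_sq_le_norm` — then `‖x‖ ≥ ‖p‖⁻²` (`‖x‖ = ‖x/y‖⁻²`, `‖x/y‖ < 1`);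
* `eval_map_ne_zero_of_coeff_eq` — leading-term domination for an integral polynomial with top
  coefficient `p` at such `x`;
* `not_prime_zsmul_eq_zero_of_one_lt_norm_unramified` — **a point `(x, y)` with `‖x‖ > 1` on an
  integral elliptic equation is not killed by `p`** (`p ≥ 3`): `p • P = O` would give `ψ_p(x) = 0`,
  but `ψ_p = p·X^{(p²−1)/2} + (lower, integral)`;
* `eq_zero_of_prime_nsmul_eq_zero_of_mem_kernel` — the same in the tree's `FormalGroupChart.kernel`
  currency: **`E₁(K)[p] = 0`** for `V` elliptic with `‖·‖₊`-integral coefficients.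

(The tree's level statement `FormalGroupChart.eq_zero_of_nsmul_eq_zero` needs `|z(Q)| < |p|`, i.e.
misses exactly the boundary level `|z| = |p|` that `e = 1 < p − 1` allows; this file closes it.)

## References
* [SilvermanAEC2009] J. H. Silverman, *The Arithmetic of Elliptic Curves*, 2nd ed. (2009), VII.3
  Prop. 3.1, IV.6 Thm. 6.1; Exercise 3.7(d),(f) (method).
-/

noncomputable section

open scoped Classical NNReal
open _root_.WeierstrassCurve _root_.Polynomial

namespace Literature.NumberTheory.EllipticCurves

namespace UnramifiedKernelTorsion

variable {K : Type*} [NontriviallyNormedField K] [IsUltrametricDist K]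
  {R : Type*} [CommRing R] (f : R →+* K)

/-- **`‖y‖² = ‖x‖³` for a point `(x, y)` with `‖x‖ > 1` on an integral equation** over an
ultrametric field (the cubic term dominates). [cite: SilvermanAEC2009, VII.2.2 (proof)] -/
theorem norm_sq_eq_norm_cube (hf : ∀ r, ‖f r‖ ≤ 1) (W₀ : WeierstrassCurve R) {x y : K}
    (heq : (W₀.map f).toAffine.Equation x y) (hx : 1 < ‖x‖) : ‖y‖ ^ 2 = ‖x‖ ^ 3 := by
  rw [Affine.equation_iff] at heq
  simp only [map_a₁, map_a₂, map_a₃, map_a₄, map_a₆] at heq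
  have hx0 : 0 < ‖x‖ := one_pos.trans hx
  have hx1 : 1 ≤ ‖x‖ := hx.le
  have hx2 : ‖x‖ ≤ ‖x‖ ^ 2 := by nlinarith
  have hx3 : ‖x‖ ^ 2 < ‖x‖ ^ 3 := by nlinarith
  have nadd : ∀ a b : K, ‖a + b‖ ≤ max ‖a‖ ‖b‖ := IsUltrametricDist.norm_add_le_max
  -- the right-hand side has norm `‖x‖³`
  have hr : ‖f W₀.a₂ * x ^ 2 + f W₀.a₄ * x + f W₀.a₆‖ ≤ ‖x‖ ^ 2 := by
    refine (nadd _ _).trans (max_le ((nadd _ _).trans (max_le ?_ ?_)) ((hf _).trans (one_le_pow₀ hx1)))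
    · rw [norm_mul, norm_pow]; exact mul_le_of_le_one_left (by positivity) (hf _)
    · rw [norm_mul]; exact (mul_le_of_le_one_left (norm_nonneg _) (hf _)).trans hx2
  have hR : ‖x ^ 3 + f W₀.a₂ * x ^ 2 + f W₀.a₄ * x + f W₀.a₆‖ = ‖x‖ ^ 3 := by
    rw [show x ^ 3 + f W₀.a₂ * x ^ 2 + f W₀.a₄ * x + f W₀.a₆ =
      x ^ 3 + (f W₀.a₂ * x ^ 2 + f W₀.a₄ * x + f W₀.a₆) by ring]
    rw [IsUltrametricDist.norm_add_eq_max_of_norm_ne_norm, norm_pow, max_eq_left (hr.trans hx3.le)]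
    rw [norm_pow]; exact (ne_of_lt (hr.trans_lt hx3)).symm
  have hy : ‖x‖ < ‖y‖ := by
    by_contra hle
    push Not at hle
    have hL : ‖y ^ 2 + f W₀.a₁ * x * y + f W₀.a₃ * y‖ ≤ ‖x‖ ^ 2 := by
      refine (nadd _ _).trans (max_le ((nadd _ _).trans (max_le ?_ ?_)) ?_)
      · rw [norm_pow]; exact pow_le_pow_left₀ (norm_nonneg _) hle 2
      · rw [norm_mul, norm_mul, sq]
        exact mul_le_mul (mul_le_of_le_one_left (norm_nonneg _) (hf _)) hle (norm_nonneg _)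
          (norm_nonneg _)
      · rw [norm_mul]
        exact ((mul_le_of_le_one_left (norm_nonneg _) (hf _)).trans hle).trans hx2
    rw [heq, hR] at hL
    exact absurd hL (not_le.mpr hx3)
  have hy0 : 0 < ‖y‖ := hx0.trans hy
  have hl : ‖f W₀.a₁ * x * y + f W₀.a₃ * y‖ < ‖y‖ ^ 2 := by
    refine (nadd _ _).trans_lt (max_lt ?_ ?_)
    · rw [norm_mul, norm_mul, sq]
      exact mul_lt_mul ((mul_le_of_le_one_left (norm_nonneg _) (hf _)).trans_lt hy) le_rfl hy0
        (norm_nonneg _)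
    · rw [norm_mul, sq]
      exact mul_lt_mul ((hf _).trans_lt (hx.trans hy)) le_rfl hy0 (norm_nonneg _)
  have hL : ‖y ^ 2 + f W₀.a₁ * x * y + f W₀.a₃ * y‖ = ‖y‖ ^ 2 := by
    rw [show y ^ 2 + f W₀.a₁ * x * y + f W₀.a₃ * y = y ^ 2 + (f W₀.a₁ * x * y + f W₀.a₃ * y) by ring]
    rw [IsUltrametricDist.norm_add_eq_max_of_norm_ne_norm, norm_pow, max_eq_left hl.le]
    rw [norm_pow]; exact (ne_of_lt hl).symm
  rw [← hL, heq, hR]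

/-- **`‖x‖ ≥ ‖p‖⁻²` for `‖x‖ > 1` on an integral equation over an UNRAMIFIED field** (value group
generated by `‖p‖`: `‖z‖ < 1 ⇒ ‖z‖ ≤ ‖p‖`): `‖x‖ = ‖x/y‖⁻²` with `‖x/y‖ < 1`.
[cite: SilvermanAEC2009, VII.3 Prop. 3.1 (proof)] -/
theorem inv_norm_sq_le_norm (hf : ∀ r, ‖f r‖ ≤ 1) (W₀ : WeierstrassCurve R) {p : ℕ}
    (hdisc : ∀ z : K, ‖z‖ < 1 → ‖z‖ ≤ ‖(p : K)‖) {x y : K}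
    (heq : (W₀.map f).toAffine.Equation x y) (hx : 1 < ‖x‖) :
    ‖(p : K)‖⁻¹ ^ 2 ≤ ‖x‖ := by
  have h := norm_sq_eq_norm_cube f hf W₀ heq hx
  have hx0 : 0 < ‖x‖ := one_pos.trans hx
  have hy0 : 0 < ‖y‖ := by
    rcases (norm_nonneg y).eq_or_lt with h0 | h0
    · exfalso
      rw [← h0, zero_pow two_ne_zero] at h
      have : (0 : ℝ) < ‖x‖ ^ 3 := by positivity
      rw [← h] at this
      exact lt_irrefl _ this
    · exact h0
  have ht : ‖x / y‖ ^ 2 = ‖x‖⁻¹ := by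
    rw [norm_div, div_pow, h]
    field_simp
  have ht1 : ‖x / y‖ < 1 := by
    have h1 : ‖x / y‖ ^ 2 < 1 := by rw [ht]; exact inv_lt_one_of_one_lt₀ hx
    exact (pow_lt_one_iff_of_nonneg (norm_nonneg _) two_ne_zero).mp h1
  have h3 : ‖x‖⁻¹ ≤ ‖(p : K)‖ ^ 2 := by
    rw [← ht]; exact pow_le_pow_left₀ (norm_nonneg _) (hdisc _ ht1) 2
  calc ‖(p : K)‖⁻¹ ^ 2 = (‖(p : K)‖ ^ 2)⁻¹ := by rw [inv_pow]
    _ ≤ ‖x‖⁻¹⁻¹ := inv_anti₀ (inv_pos.mpr hx0) h3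
    _ = ‖x‖ := inv_inv _

/-- **Leading-term domination**: a polynomial `Q` over `R` of degree `≤ d` (`d ≥ 1`) with top
coefficient `p`, read in `K` through `f : R → K` with `‖f r‖ ≤ 1`, does not vanish at `x` with
`‖x‖ ≥ ‖p‖⁻²` when `0 < ‖p‖ < 1`: `‖p x^d‖ = ‖p‖‖x‖^d` exceeds every `‖c_i x^i‖ ≤ ‖x‖^{d−1} ≤ ‖p‖²‖x‖^d`.
[folklore] -/
private theorem eval_map_ne_zero_of_coeff_eq (hf : ∀ r, ‖f r‖ ≤ 1) {p : ℕ} (hp0 : (p : K) ≠ 0)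
    (hp1 : ‖(p : K)‖ < 1) {Q : R[X]} {d : ℕ} (hd : 1 ≤ d) (hdeg : Q.natDegree ≤ d)
    (hcoeff : Q.coeff d = p) {x : K} (hx : ‖(p : K)‖⁻¹ ^ 2 ≤ ‖x‖) :
    (Q.map f).eval x ≠ 0 := by
  have hπ : 0 < ‖(p : K)‖ := norm_pos_iff.mpr hp0
  have hx1 : 1 ≤ ‖x‖ := by
    refine le_trans ?_ hx
    rw [inv_pow]
    exact (one_le_inv₀ (by positivity)).mpr (pow_le_one₀ hπ.le hp1.le)
  have hx0 : 0 < ‖x‖ := one_pos.trans_le hx1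
  set Q' := Q.map f with hQ'
  have hdeg' : Q'.natDegree < d + 1 := (natDegree_map_le).trans_lt (Nat.lt_succ_of_le hdeg)
  rw [eval_eq_sum_range' hdeg', Finset.sum_range_succ]
  have htop : Q'.coeff d * x ^ d = (p : K) * x ^ d := by
    rw [hQ', coeff_map, hcoeff, map_natCast]
  have hntop : ‖(p : K) * x ^ d‖ = ‖(p : K)‖ * ‖x‖ ^ d := by rw [norm_mul, norm_pow]
  have hlow : ‖∑ i ∈ Finset.range d, Q'.coeff i * x ^ i‖ ≤ ‖(p : K)‖ ^ 2 * ‖x‖ ^ d := by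
    refine IsUltrametricDist.norm_sum_le_of_forall_le_of_nonneg (by positivity) fun i hi => ?_
    rw [Finset.mem_range] at hi
    have hc : ‖Q'.coeff i‖ ≤ 1 := by rw [hQ', coeff_map]; exact hf _
    calc ‖Q'.coeff i * x ^ i‖ = ‖Q'.coeff i‖ * ‖x‖ ^ i := by rw [norm_mul, norm_pow]
      _ ≤ 1 * ‖x‖ ^ (d - 1) :=
          mul_le_mul hc (pow_le_pow_right₀ hx1 (by omega)) (by positivity) zero_le_one
      _ = ‖x‖ ^ d * ‖x‖⁻¹ := by
          rw [one_mul, ← div_eq_mul_inv, eq_div_iff hx0.ne', ← pow_succ, Nat.sub_add_cancel hd]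
      _ ≤ ‖x‖ ^ d * ‖(p : K)‖ ^ 2 := by
          gcongr
          calc ‖x‖⁻¹ ≤ (‖(p : K)‖⁻¹ ^ 2)⁻¹ := inv_anti₀ (by positivity) hx
            _ = ‖(p : K)‖ ^ 2 := by rw [inv_pow, inv_inv]
      _ = ‖(p : K)‖ ^ 2 * ‖x‖ ^ d := by ring
  intro h0
  rw [htop, add_eq_zero_iff_eq_neg] at h0
  have h1 : ‖∑ i ∈ Finset.range d, Q'.coeff i * x ^ i‖ = ‖(p : K)‖ * ‖x‖ ^ d := by
    rw [h0, norm_neg, hntop]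
  rw [h1] at hlow
  have hxd : 0 < ‖x‖ ^ d := by positivity
  have : ‖(p : K)‖ ≤ ‖(p : K)‖ ^ 2 := le_of_mul_le_mul_right hlow hxd
  nlinarith

/-- A prime `p ≥ 3` is `2j + 3` for some `j`. [folklore] -/
private theorem exists_eq_two_mul_add_three' {p : ℕ} [Fact p.Prime] (hp3 : 3 ≤ p) :
    ∃ j : ℕ, p = 2 * j + 3 := by
  rcases (Fact.out : p.Prime).eq_two_or_odd' with h2 | ⟨k, hk⟩
  · omega
  · exact ⟨k - 1, by omega⟩

/-- **`E₁(K)[p] = 0` over an unramified `p`-adic field, `p ≥ 3`, affine form** (Silverman, *AEC*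
VII.3 Prop. 3.1 with IV.6 Thm. 6.1 for `e = v(p) = 1 < p − 1`): on an equation with integral
coefficients (`W₀` over `R`, read in `K` through `f` with `‖f r‖ ≤ 1`) over an ultrametric field `K`
in which `0 < ‖p‖ < 1` and `‖z‖ < 1 ⇒ ‖z‖ ≤ ‖p‖`, a point `(x, y)` with `‖x‖ > 1` is not killed by
`p`.  Proof by division polynomials as in the tree's `ℚ_p` case
(`not_prime_zsmul_eq_zero_of_one_lt_norm`): `p • P = O` would give `ψ_p(x) = 0`, while
`ψ_p = p·X^{(p²−1)/2} + (lower, integral)` and `‖x‖ ≥ ‖p‖⁻²`.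
[cite: SilvermanAEC2009, VII.3 Prop. 3.1 and IV.6 Thm. 6.1 (statement); Exercise 3.7(d),(f) (method)] -/
theorem not_prime_zsmul_eq_zero_of_one_lt_norm_unramified (hf : ∀ r, ‖f r‖ ≤ 1)
    (W₀ : WeierstrassCurve R) [(W₀.map f).IsElliptic] {p : ℕ} [Fact p.Prime] (hp3 : 3 ≤ p)
    (hp0 : (p : K) ≠ 0) (hp1 : ‖(p : K)‖ < 1) (hdisc : ∀ z : K, ‖z‖ < 1 → ‖z‖ ≤ ‖(p : K)‖)
    {x y : K} (h : (W₀.map f).toAffine.Nonsingular x y) (hx : 1 < ‖x‖) :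
    (p : ℤ) • (Affine.Point.some x y h : (W₀.map f).toAffine.Point) ≠ 0 := by
  obtain ⟨j, hj⟩ := exists_eq_two_mul_add_three' hp3
  have hodd : ¬ Even p := by rw [hj, Nat.not_even_iff_odd]; exact ⟨j + 1, by ring⟩
  intro h0
  rw [zsmul_eq_zero_iff_evalEval_ψ_holds (W₀.map f) (p : ℤ) h] at h0
  have h1 := evalEval_ψ_sq (W₀.map f) h.1 (p : ℤ)
  rw [h0, zero_pow two_ne_zero, ΨSq_ofNat, if_neg hodd, mul_one, eval_pow, eq_comm,
    pow_eq_zero_iff two_ne_zero] at h1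
  rw [map_preΨ'] at h1
  have hx2 := inv_norm_sq_le_norm f hf W₀ hdisc h.1 hx
  refine eval_map_ne_zero_of_coeff_eq f hf hp0 hp1 (d := (p ^ 2 - 1) / 2) ?_ ?_ ?_ hx2 h1
  · rw [hj]
    have : (2 * j + 3) ^ 2 - 1 = 2 * (2 * j ^ 2 + 6 * j + 4) := by
      rw [Nat.sub_eq_iff_eq_add (Nat.one_le_pow _ _ (by omega))]; ring
    rw [this, Nat.mul_div_cancel_left _ two_pos]
    omega
  · have := W₀.natDegree_preΨ'_le p
    rwa [if_neg hodd] at this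
  · have := W₀.coeff_preΨ' p
    rwa [if_neg hodd, if_neg hodd] at this

/-- **`E₁(K)[p] = 0` over an unramified `p`-adic field, `p ≥ 3`** (Silverman, *AEC* VII.3.1 with
IV.6.1), in the tree's `FormalGroupChart.kernel` currency: for `V` elliptic over an ultrametric
normed field `K` with `‖·‖₊`-integral coefficients, `0 < ‖p‖ < 1` and `‖z‖ < 1 ⇒ ‖z‖ ≤ ‖p‖`, a point of
the kernel of reduction `E₁(K)` killed by `p` is `O`.
[cite: SilvermanAEC2009, VII.3 Prop. 3.1 and IV.6 Thm. 6.1] -/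
theorem eq_zero_of_prime_nsmul_eq_zero_of_mem_kernel (V : WeierstrassCurve K) [V.IsElliptic]
    [hV : V.IsIntegral (NormedField.valuation : Valuation K ℝ≥0).integer] {p : ℕ} [Fact p.Prime]
    (hp3 : 3 ≤ p) (hp0 : (p : K) ≠ 0) (hp1 : ‖(p : K)‖ < 1)
    (hdisc : ∀ z : K, ‖z‖ < 1 → ‖z‖ ≤ ‖(p : K)‖) (P : V.toAffine.Point)
    (hP : P ∈ FormalGroupChart.kernel (NormedField.valuation : Valuation K ℝ≥0) V) (hpP : p • P = 0) :
    P = 0 := by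
  obtain ⟨W₀, hW₀⟩ := hV.integral
  subst hW₀
  rcases P with _ | ⟨x, y, h⟩
  · rfl
  · exfalso
    have hx : 1 < (NormedField.valuation : Valuation K ℝ≥0) x := hP rfl
    have hx' : 1 < ‖x‖ := by
      rw [NormedField.valuation_apply, ← NNReal.coe_lt_coe, NNReal.coe_one, coe_nnnorm] at hx
      exact hx
    have hf : ∀ r : (NormedField.valuation : Valuation K ℝ≥0).integer, ‖algebraMap _ K r‖ ≤ 1 := by
      intro r
      have hr := r.2
      rw [Valuation.mem_integer_iff, NormedField.valuation_apply, ← NNReal.coe_le_coe, NNReal.coe_one,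
        coe_nnnorm] at hr
      exact hr
    have h0 : (p : ℤ) • (Affine.Point.some x y h) = 0 := by rwa [natCast_zsmul]
    haveI : (W₀.map (algebraMap (NormedField.valuation : Valuation K ℝ≥0).integer K)).IsElliptic :=
      ‹(W₀.baseChange K).IsElliptic›
    exact not_prime_zsmul_eq_zero_of_one_lt_norm_unramified (algebraMap _ K) hf W₀ hp3 hp0 hp1
      hdisc h hx' h0

end UnramifiedKernelTorsion

end Literature.NumberTheory.EllipticCurves
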